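import Literature.InformationTheory.Coding.MacWilliamsIdentitySubmodule
import Literature.InformationTheory.QuantumCodes.CSSStabilizer
import Literature.InformationTheory.QuantumCodes.ParityCheckDuality
import Summits.Ventures.QEC.Census.CSSZeroRate
import HarnessLib

/-!
# The CSS linear program and its Farkas certificates: «no CSS `[[n, k, D]]`» in the kernel

LADDER-QEC (venture cell `qec`), CENSUS-PREREG C.2 (CSS calibration grid, `n ≤ 12`), item 02.CSSLP (qec-type-02). qec-search-5
(census/search-5/css-n12, `code/css.py`) bounds the distance of EVERY CSS code of a cell `(n, k)` by a linear-programming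
relaxation «derived from definitions»: for a CSS code with `X`-stabilizer span `A = rs H^X` (`dim a`) and `Z`-stabilizer
span `B = rs H^Z` (`dim b`, `a + b = n − k`, `A ⊆ B⊥`, `B ⊆ A⊥`), the weight distributions `α_j = #{v ∈ A : |v| = j}`,
`β_j = #{v ∈ B : |v| = j}` satisfy

  `α_0 = β_0 = 1`, `Σ_j α_j = 2^a`, `Σ_j β_j = 2^b`, `α, β ≥ 0`,
  `2^a β_j ≤ Σ_r K_j(r) α_r` (`= 2^a · #{v ∈ A⊥ : |v| = j}`, binary MacWilliams) and `2^b α_j ≤ Σ_r K_j(r) β_r` for all `j`,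
  with EQUALITY for `j ≤ D − 1` when the code has no logical operator of weight `< D` (`A⊥ ∖ B` and `B⊥ ∖ A` have no word
  of weight `< D`), and `α_j = β_j = 0` (`1 ≤ j ≤ D − 1`) for a zero-rate code all of whose nonzero stabilizers have
  weight `≥ D` (CRSS `k = 0` convention).

(We do NOT use search-5's extra w.l.o.g. `α_1 = β_1 = 0`, which needs a puncturing lemma; measured: unnecessary for every
C.2 cell.) If this system is infeasible over `ℚ`, no such CSS code exists. This file makes that a KERNEL statement:

* a tiny generic LP layer: `LPRow` (coefficients on the `α`- and `β`-blocks, right-hand side, `=`/`≥`), `LPRow.Sat`,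
  `LPFeasible rows n α β` (a nonnegative point satisfying every row), and the **Farkas checker** `farkasCheck rows ys n`
  (multipliers `ys`, one per row, nonnegative on `≥`-rows; the combined coefficient of every variable `≤ 0` and the combined
  constant `< 0` — exact rational arithmetic, `decide`) with its weak-duality soundness `not_lpFeasible_of_farkasCheck`
  [MacWilliams–Sloane Ch. 17 §4 Thm. 20: dual-feasible vectors as certificates — the pattern of type-06's
  `Census/LPCertificate.lean` for CRSS's LP];
* the **CSS system** `cssLPRows n a b D k0 : List LPRow` (computable: binary Krawtchouk numbers `krawtchouk` of
  `Coding/DelsarteLPBound.lean`) and its SOUNDNESS `lpFeasible_cssLPRows_of_le` (`k ≥ 1` codes with `D ≤ d^X`, `D ≤ d^Z`)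
  / `lpFeasible_cssLPRows_zero` (`k = 0`): the weight distributions (`wdist`, Literature/…/Coding/MacWilliamsIdentitySubmodule.lean)
  are a feasible point — by MacWilliams for `𝔽₂`-submodules (`pow_finrank_mul_wdist_dualCode`), `B ≤ A⊥ = ker H^X`
  (`dualCode_rowSpace`, `CSSCode.rowSpZ_le_kerX`) and «below `d^Z` every `Z`-logical candidate is a stabilizer»
  (`CSSCode.mem_rowSpX_of_hammingNorm_lt_dX` for the swapped code);
* the census form: **`css_min_dX_dZ_lt_of_farkasCheck`** — a checked certificate for `(n, a, b, D)` gives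
  `min (d^X, d^Z) < D` for every CSS code on `n` qubits with `rank H^X = a`, `rank H^Z = b`; and
  **`css_exists_stabilizer_lt_of_farkasCheck`** (`k = 0`, `a + b = n`): some nonzero stabilizer has weight `< D`.
  The per-cell files `Census/CSS/UpperLP*.lean` case-split on `rank H^X` and discharge each split by `decide +kernel`.
HONEST FRAMING: the LP is a RELAXATION — infeasibility refutes existence, feasibility proves nothing; nothing here computes
a distance. The checker trusts no producer: it recomputes every Krawtchouk number and every rational combination.
Certificates: qec-type-02's `gen_certs.py` (exact-rational simplex `qlp.phase1` of qec-search-5 + conversion), 211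
certificates for the 25 C.2 cells not settled by the additive bounds. [folklore] throughout (weak LP duality; MacWilliams).
-/

namespace Summit.Ventures.QEC.Census

open Finset Literature.InformationTheory.Coding Literature.InformationTheory.QuantumCodes

/-! ## A two-block linear system and its Farkas checker -/

/-- One linear constraint `Σ_{r ≤ n} cA r · α_r + Σ_{r ≤ n} cB r · β_r  (= | ≥)  rhs` on the two blocks. (definition, ours) [folklore] -/
structure LPRow where
  /-- coefficient of `α_r` -/
  cA : ℕ → ℚ
  /-- coefficient of `β_r` -/
  cB : ℕ → ℚ
  /-- right-hand side -/
  rhs : ℚ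
  /-- `true`: equality row; `false`: `≥` row -/
  isEq : Bool

namespace LPRow

/-- The left-hand side of a row at a point `(α, β)`. [folklore] -/
def eval (row : LPRow) (n : ℕ) (α β : ℕ → ℚ) : ℚ :=
  ∑ r ∈ range (n + 1), row.cA r * α r + ∑ r ∈ range (n + 1), row.cB r * β r

/-- A point satisfies a row: equality rows exactly, `≥` rows from below. (A predicate with parameters, ours — not a
named fact.) [cite: MacWilliamsSloane1977, Ch. 17 §4 Thm. 20 (primal/dual feasibility; dual vectors as certificates)] -/
structure Sat (row : LPRow) (n : ℕ) (α β : ℕ → ℚ) : Prop where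
  /-- an equality row holds exactly -/
  eq_of_isEq : row.isEq = true → row.eval n α β = row.rhs
  /-- a `≥` row holds from below -/
  le_of_isEq : row.isEq = false → row.rhs ≤ row.eval n α β

/-- A satisfied row, times a multiplier of the right sign, contributes `≥ 0`: `y · (eval − rhs) ≥ 0`. [folklore] -/
theorem mul_sub_nonneg {row : LPRow} {n : ℕ} {α β : ℕ → ℚ} (h : row.Sat n α β) {y : ℚ} (hy : row.isEq = true ∨ 0 ≤ y) :
    0 ≤ y * (row.eval n α β - row.rhs) := by
  cases hq : row.isEq
  · rw [hq] at hy
    simp only [Bool.false_eq_true, false_or] at hy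
    exact mul_nonneg hy (sub_nonneg.2 (h.le_of_isEq hq))
  · rw [h.eq_of_isEq hq, sub_self, mul_zero]

end LPRow

/-- `(α, β)` is a nonnegative point satisfying every row of the system. (A predicate with parameters, ours — not a
named fact.) [cite: MacWilliamsSloane1977, Ch. 17 §4 Thm. 20 (primal feasibility; dual vectors as certificates)] -/
structure LPFeasible (rows : List LPRow) (n : ℕ) (α β : ℕ → ℚ) : Prop where
  /-- `α ≥ 0` -/
  nonnegA : ∀ r, 0 ≤ α r
  /-- `β ≥ 0` -/
  nonnegB : ∀ r, 0 ≤ β r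
  /-- every row is satisfied -/
  sat : ∀ row ∈ rows, row.Sat n α β

/-- Combined coefficient of `α_r` for multipliers `ys` (rows beyond the shorter list count with multiplier `0`). [folklore] -/
def kapA (rows : List LPRow) (ys : List ℚ) (r : ℕ) : ℚ := ((rows.zip ys).map fun p => p.2 * p.1.cA r).sum

/-- Combined coefficient of `β_r`. [folklore] -/
def kapB (rows : List LPRow) (ys : List ℚ) (r : ℕ) : ℚ := ((rows.zip ys).map fun p => p.2 * p.1.cB r).sum

/-- Combined constant `−Σ y_i rhs_i`. [folklore] -/
def kapC (rows : List LPRow) (ys : List ℚ) : ℚ := -((rows.zip ys).map fun p => p.2 * p.1.rhs).sum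

/-- **The Farkas checker**: multipliers of `≥`-rows are nonnegative, every combined variable coefficient is `≤ 0`, and the
combined constant is `< 0`. Pure `Bool`, exact rationals: close instances by `decide`. [folklore] -/
def farkasCheck (rows : List LPRow) (ys : List ℚ) (n : ℕ) : Bool :=
  ((rows.zip ys).all fun p => p.1.isEq || decide (0 ≤ p.2)) &&
  ((List.range (n + 1)).all fun r => decide (kapA rows ys r ≤ 0) && decide (kapB rows ys r ≤ 0)) &&
  decide (kapC rows ys < 0)

/-- Regrouping `Σ_i y_i (eval_i − rhs_i) = Σ_r (Σ_i y_i cA_i r) α_r + Σ_r (Σ_i y_i cB_i r) β_r − Σ_i y_i rhs_i`. [folklore] -/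
theorem sum_mul_eval_sub (L : List (LPRow × ℚ)) (n : ℕ) (α β : ℕ → ℚ) :
    (L.map fun p => p.2 * (p.1.eval n α β - p.1.rhs)).sum =
      ∑ r ∈ range (n + 1), (L.map fun p => p.2 * p.1.cA r).sum * α r +
      ∑ r ∈ range (n + 1), (L.map fun p => p.2 * p.1.cB r).sum * β r - (L.map fun p => p.2 * p.1.rhs).sum := by
  induction L with
  | nil => simp
  | cons p L ih =>
    have hA : ∑ r ∈ range (n + 1), p.2 * (p.1.cA r * α r) = ∑ r ∈ range (n + 1), p.2 * p.1.cA r * α r :=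
      Finset.sum_congr rfl fun r _ => by ring
    have hB : ∑ r ∈ range (n + 1), p.2 * (p.1.cB r * β r) = ∑ r ∈ range (n + 1), p.2 * p.1.cB r * β r :=
      Finset.sum_congr rfl fun r _ => by ring
    simp only [List.map_cons, List.sum_cons, ih, add_mul, Finset.sum_add_distrib]
    unfold LPRow.eval
    rw [mul_sub, mul_add, Finset.mul_sum, Finset.mul_sum, hA, hB]
    ring

/-- Unpacking a successful check. [folklore] -/
theorem farkasCheck_spec {rows : List LPRow} {ys : List ℚ} {n : ℕ} (h : farkasCheck rows ys n = true) :
    (∀ p ∈ rows.zip ys, p.1.isEq = true ∨ 0 ≤ p.2) ∧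
    (∀ r, r ≤ n → kapA rows ys r ≤ 0 ∧ kapB rows ys r ≤ 0) ∧ kapC rows ys < 0 := by
  simp only [farkasCheck, Bool.and_eq_true, List.all_eq_true, Bool.or_eq_true, decide_eq_true_eq, List.mem_range] at h
  obtain ⟨⟨h1, h2⟩, h3⟩ := h
  exact ⟨h1, fun r hr => h2 r (by omega), h3⟩

/-- **Weak duality (Farkas)**: a checked certificate refutes feasibility. [cite-free; folklore] For a feasible nonnegative
point the combined functional `Σ_i y_i (eval_i − rhs_i)` is `≥ 0` row by row, but regrouped it is
`Σ_r κA_r α_r + Σ_r κB_r β_r + κC ≤ κC < 0`. [folklore] -/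
theorem not_lpFeasible_of_farkasCheck {rows : List LPRow} {ys : List ℚ} {n : ℕ} (h : farkasCheck rows ys n = true)
    {α β : ℕ → ℚ} : ¬ LPFeasible rows n α β := by
  rintro ⟨hα, hβ, hsat⟩
  obtain ⟨hsign, hkap, hC⟩ := farkasCheck_spec h
  set L := rows.zip ys with hL
  -- (i) row by row the functional is nonnegative
  have hpos : 0 ≤ (L.map fun p => p.2 * (p.1.eval n α β - p.1.rhs)).sum := by
    refine List.sum_nonneg fun x hx => ?_
    rw [List.mem_map] at hx
    obtain ⟨p, hp, rfl⟩ := hx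
    have hrow : p.1 ∈ rows := (List.of_mem_zip hp).1
    exact LPRow.mul_sub_nonneg (hsat p.1 hrow) (hsign p hp)
  -- (ii) regrouped it is ≤ κC < 0
  rw [sum_mul_eval_sub] at hpos
  have hA : ∑ r ∈ range (n + 1), (L.map fun p => p.2 * p.1.cA r).sum * α r ≤ 0 :=
    Finset.sum_nonpos fun r hr => mul_nonpos_of_nonpos_of_nonneg
      (by have := (hkap r (by rw [mem_range] at hr; omega)).1; rwa [kapA, ← hL] at this) (hα r)
  have hB : ∑ r ∈ range (n + 1), (L.map fun p => p.2 * p.1.cB r).sum * β r ≤ 0 :=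
    Finset.sum_nonpos fun r hr => mul_nonpos_of_nonpos_of_nonneg
      (by have := (hkap r (by rw [mem_range] at hr; omega)).2; rwa [kapB, ← hL] at this) (hβ r)
  have hC' : -(L.map fun p => p.2 * p.1.rhs).sum < 0 := by rwa [kapC, ← hL] at hC
  linarith

/-! ## The CSS linear program -/

/-- Row «`α_j = c`» (`cB = 0`). [folklore] -/
def rowAlphaEq (j : ℕ) (c : ℚ) : LPRow := ⟨fun r => if r = j then 1 else 0, fun _ => 0, c, true⟩
/-- Row «`β_j = c`». [folklore] -/
def rowBetaEq (j : ℕ) (c : ℚ) : LPRow := ⟨fun _ => 0, fun r => if r = j then 1 else 0, c, true⟩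

/-- Row «`Σ_r α_r = c`». [folklore] -/
def rowAlphaSum (c : ℚ) : LPRow := ⟨fun _ => 1, fun _ => 0, c, true⟩
/-- Row «`Σ_r β_r = c`». [folklore] -/
def rowBetaSum (c : ℚ) : LPRow := ⟨fun _ => 0, fun _ => 1, c, true⟩

/-- The MacWilliams row for `A⊥` at weight `j`: `Σ_r K_j(r) α_r − 2^a β_j (= 0 if j + 1 ≤ D, else ≥ 0)` — `2^a` times
«`#{v ∈ A⊥ : |v| = j} ≥ β_j`, with equality below `D`». [folklore] -/
def rowDualA (n a D j : ℕ) : LPRow :=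
  ⟨fun r => (krawtchouk n j r : ℚ), fun r => if r = j then -(2 : ℚ) ^ a else 0, 0, decide (j + 1 ≤ D)⟩

/-- The MacWilliams row for `B⊥` at weight `j`: `Σ_r K_j(r) β_r − 2^b α_j (= 0 | ≥ 0)`. [folklore] -/
def rowDualB (n b D j : ℕ) : LPRow :=
  ⟨fun r => if r = j then -(2 : ℚ) ^ b else 0, fun r => (krawtchouk n j r : ℚ), 0, decide (j + 1 ≤ D)⟩

/-- **The CSS linear program** for length `n`, dimensions `(a, b)` of the two stabilizer spans and target distance `D`
(`k0 = true` adds the zero-rate convention rows `α_j = β_j = 0`, `1 ≤ j ≤ D − 1`). Row order (= multiplier order of the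
certificates): `α_0 = 1`, `β_0 = 1`, `Σ α = 2^a`, `Σ β = 2^b`, then for `j = 0, …, n` the pair (dual-`A` row `j`,
dual-`B` row `j`), then (if `k0`) for `j = 1, …, D − 1` the pair (`α_j = 0`, `β_j = 0`). Column: definition (ours, =
qec-search-5's CSS-LP at length `n` without its `α_1 = β_1 = 0` w.l.o.g.). [folklore] -/
def cssLPRows (n a b D : ℕ) (k0 : Bool) : List LPRow :=
  [rowAlphaEq 0 1, rowBetaEq 0 1, rowAlphaSum ((2 : ℚ) ^ a), rowBetaSum ((2 : ℚ) ^ b)] ++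
    (List.range (n + 1)).flatMap (fun j => [rowDualA n a D j, rowDualB n b D j]) ++
    (if k0 then ((List.range (D - 1)).map (· + 1)).flatMap (fun j => [rowAlphaEq j 0, rowBetaEq j 0]) else [])

/-! ## Soundness: the weight distributions of a CSS code are a feasible point -/

section Soundness

variable {n : ℕ} {RX RZ : Type*} [Fintype RX] [Fintype RZ]

/-- The `α`-block of a CSS code: weight distribution of `A = rs H^X`, as rationals. [folklore] -/
noncomputable def alphaOf (C : CSSCode RX RZ (Fin n)) (r : ℕ) : ℚ := (wdist C.rowSpX r : ℚ)

/-- The `β`-block: weight distribution of `B = rs H^Z`. [folklore] -/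
noncomputable def betaOf (C : CSSCode RX RZ (Fin n)) (r : ℕ) : ℚ := (wdist C.rowSpZ r : ℚ)

/-- Evaluating a row with an indicator coefficient picks one unknown. [folklore] -/
private theorem sum_ite_eq_mul (n j : ℕ) (hj : j ≤ n) (c : ℚ) (x : ℕ → ℚ) :
    ∑ r ∈ range (n + 1), (if r = j then c else 0) * x r = c * x j := by
  rw [Finset.sum_eq_single_of_mem j (by rw [mem_range]; omega) (fun r _ hr => by rw [if_neg hr, zero_mul]), if_pos rfl]

/-- The `α_0 = 1` row holds (`A_0 = 1`). [folklore] -/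
theorem sat_rowAlphaEq_zero (C : CSSCode RX RZ (Fin n)) : (rowAlphaEq 0 1).Sat n (alphaOf C) (betaOf C) := by
  refine ⟨fun _ => ?_, fun h => absurd h (by simp [rowAlphaEq])⟩
  simp only [rowAlphaEq, LPRow.eval, zero_mul, Finset.sum_const_zero, add_zero]
  rw [sum_ite_eq_mul n 0 (Nat.zero_le n), one_mul, alphaOf, wdist_zero, Nat.cast_one]

/-- The `β_0 = 1` row holds. [folklore] -/
theorem sat_rowBetaEq_zero (C : CSSCode RX RZ (Fin n)) : (rowBetaEq 0 1).Sat n (alphaOf C) (betaOf C) := by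
  refine ⟨fun _ => ?_, fun h => absurd h (by simp [rowBetaEq])⟩
  simp only [rowBetaEq, LPRow.eval, zero_mul, Finset.sum_const_zero, zero_add]
  rw [sum_ite_eq_mul n 0 (Nat.zero_le n), one_mul, betaOf, wdist_zero, Nat.cast_one]

/-- The `Σ α = 2^a` row holds when `rank H^X = a` (`|A| = 2^{dim A}`, `dim rs H^X = rank H^X`). [folklore] -/
theorem sat_rowAlphaSum (C : CSSCode RX RZ (Fin n)) {a : ℕ} (ha : C.HX.rank = a) :
    (rowAlphaSum ((2 : ℚ) ^ a)).Sat n (alphaOf C) (betaOf C) := by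
  refine ⟨fun _ => ?_, fun h => absurd h (by simp [rowAlphaSum])⟩
  simp only [rowAlphaSum, LPRow.eval, one_mul, zero_mul, Finset.sum_const_zero, add_zero]
  unfold alphaOf
  rw [← Nat.cast_sum, sum_wdist, finrank_rowSpace_eq_rank, ha]
  push_cast; rfl

/-- The `Σ β = 2^b` row holds when `rank H^Z = b`. [folklore] -/
theorem sat_rowBetaSum (C : CSSCode RX RZ (Fin n)) {b : ℕ} (hb : C.HZ.rank = b) :
    (rowBetaSum ((2 : ℚ) ^ b)).Sat n (alphaOf C) (betaOf C) := by
  refine ⟨fun _ => ?_, fun h => absurd h (by simp [rowBetaSum])⟩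
  simp only [rowBetaSum, LPRow.eval, one_mul, zero_mul, Finset.sum_const_zero, zero_add]
  unfold betaOf
  rw [← Nat.cast_sum, sum_wdist, finrank_rowSpace_eq_rank, hb]
  push_cast; rfl

/-- Value of the dual-`A` row: `2^a · (#{v ∈ ker H^X : |v| = j} − β_j)` (MacWilliams for `A = rs H^X`, whose dual code is
`ker H^X`). [folklore] -/
theorem eval_rowDualA (C : CSSCode RX RZ (Fin n)) {a : ℕ} (ha : C.HX.rank = a) (D j : ℕ) (hj : j ≤ n) :
    (rowDualA n a D j).eval n (alphaOf C) (betaOf C) = (2 : ℚ) ^ a * ((wdist C.kerX j : ℚ) - wdist C.rowSpZ j) := by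
  simp only [rowDualA, LPRow.eval]
  rw [sum_ite_eq_mul n j hj]
  have hmw := pow_finrank_mul_wdist_dualCode C.rowSpX j
  rw [finrank_rowSpace_eq_rank, ha, show dualCode C.rowSpX = C.kerX from dualCode_rowSpace C.HX] at hmw
  have hmw' : ((2 : ℚ) ^ a) * (wdist C.kerX j : ℚ) = ∑ i ∈ range (n + 1), (wdist C.rowSpX i : ℚ) * (krawtchouk n j i : ℚ) := by
    exact_mod_cast hmw
  unfold alphaOf betaOf
  rw [mul_sub, hmw']
  have : ∑ r ∈ range (n + 1), (krawtchouk n j r : ℚ) * (wdist C.rowSpX r : ℚ) =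
      ∑ i ∈ range (n + 1), (wdist C.rowSpX i : ℚ) * (krawtchouk n j i : ℚ) := Finset.sum_congr rfl fun r _ => mul_comm _ _
  rw [this]; ring

/-- Value of the dual-`B` row: `2^b · (#{v ∈ ker H^Z : |v| = j} − α_j)`. [folklore] -/
theorem eval_rowDualB (C : CSSCode RX RZ (Fin n)) {b : ℕ} (hb : C.HZ.rank = b) (D j : ℕ) (hj : j ≤ n) :
    (rowDualB n b D j).eval n (alphaOf C) (betaOf C) = (2 : ℚ) ^ b * ((wdist C.kerZ j : ℚ) - wdist C.rowSpX j) := by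
  simp only [rowDualB, LPRow.eval]
  rw [sum_ite_eq_mul n j hj]
  have hmw := pow_finrank_mul_wdist_dualCode C.rowSpZ j
  rw [finrank_rowSpace_eq_rank, hb, show dualCode C.rowSpZ = C.kerZ from dualCode_rowSpace C.HZ] at hmw
  have hmw' : ((2 : ℚ) ^ b) * (wdist C.kerZ j : ℚ) = ∑ i ∈ range (n + 1), (wdist C.rowSpZ i : ℚ) * (krawtchouk n j i : ℚ) := by
    exact_mod_cast hmw
  unfold alphaOf betaOf
  rw [mul_sub, hmw']
  have : ∑ r ∈ range (n + 1), (krawtchouk n j r : ℚ) * (wdist C.rowSpZ r : ℚ) =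
      ∑ i ∈ range (n + 1), (wdist C.rowSpZ i : ℚ) * (krawtchouk n j i : ℚ) := Finset.sum_congr rfl fun r _ => mul_comm _ _
  rw [this]; ring

/-- The dual-`A` row is satisfied: `≥ 0` always (`rs H^Z ≤ ker H^X`), `= 0` for `j + 1 ≤ D ≤ d^Z` (below the `Z`-distance
every word of `ker H^X` of that weight is a `Z`-stabilizer). [folklore] -/
theorem sat_rowDualA (C : CSSCode RX RZ (Fin n)) {a : ℕ} (ha : C.HX.rank = a) {D j : ℕ} (hj : j ≤ n)
    (hD : j + 1 ≤ D → ∀ v : Fin n → ZMod 2, v ∈ C.kerX → hammingNorm v = j → v ∈ C.rowSpZ) :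
    (rowDualA n a D j).Sat n (alphaOf C) (betaOf C) := by
  refine ⟨fun hjD => ?_, fun _ => ?_⟩
  · rw [eval_rowDualA C ha D j hj, show (rowDualA n a D j).rhs = 0 from rfl,
      wdist_eq_of_forall_mem C.rowSpZ_le_kerX (hD (of_decide_eq_true hjD)), sub_self, mul_zero]
  · rw [eval_rowDualA C ha D j hj, show (rowDualA n a D j).rhs = 0 from rfl]
    exact mul_nonneg (pow_nonneg zero_le_two _) (sub_nonneg.2 (by exact_mod_cast wdist_mono C.rowSpZ_le_kerX j))

/-- The dual-`B` row is satisfied (`rs H^X ≤ ker H^Z`; equality below `d^X`). [folklore] -/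
theorem sat_rowDualB (C : CSSCode RX RZ (Fin n)) {b : ℕ} (hb : C.HZ.rank = b) {D j : ℕ} (hj : j ≤ n)
    (hD : j + 1 ≤ D → ∀ v : Fin n → ZMod 2, v ∈ C.kerZ → hammingNorm v = j → v ∈ C.rowSpX) :
    (rowDualB n b D j).Sat n (alphaOf C) (betaOf C) := by
  refine ⟨fun hjD => ?_, fun _ => ?_⟩
  · rw [eval_rowDualB C hb D j hj, show (rowDualB n b D j).rhs = 0 from rfl,
      wdist_eq_of_forall_mem C.rowSpX_le_kerZ (hD (of_decide_eq_true hjD)), sub_self, mul_zero]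
  · rw [eval_rowDualB C hb D j hj, show (rowDualB n b D j).rhs = 0 from rfl]
    exact mul_nonneg (pow_nonneg zero_le_two _) (sub_nonneg.2 (by exact_mod_cast wdist_mono C.rowSpX_le_kerZ j))

/-- Membership in the CSS row list, unfolded. [folklore] -/
private theorem mem_cssLPRows {n a b D : ℕ} {k0 : Bool} {row : LPRow} (h : row ∈ cssLPRows n a b D k0) :
    row = rowAlphaEq 0 1 ∨ row = rowBetaEq 0 1 ∨ row = rowAlphaSum ((2 : ℚ) ^ a) ∨ row = rowBetaSum ((2 : ℚ) ^ b) ∨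
      (∃ j, j ≤ n ∧ (row = rowDualA n a D j ∨ row = rowDualB n b D j)) ∨
      (k0 = true ∧ ∃ j, 1 ≤ j ∧ j + 1 ≤ D ∧ (row = rowAlphaEq j 0 ∨ row = rowBetaEq j 0)) := by
  unfold cssLPRows at h
  simp only [List.mem_append, List.mem_cons, List.not_mem_nil, or_false, List.mem_flatMap, List.mem_range] at h
  rcases h with (h | h) | h
  · rcases h with h | h | h | h
    · exact Or.inl h
    · exact Or.inr (Or.inl h)
    · exact Or.inr (Or.inr (Or.inl h))
    · exact Or.inr (Or.inr (Or.inr (Or.inl h)))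
  · obtain ⟨j, hj, hrow⟩ := h
    exact Or.inr (Or.inr (Or.inr (Or.inr (Or.inl ⟨j, by omega, hrow⟩))))
  · cases hk : k0
    · rw [hk] at h; simp at h
    · rw [hk] at h
      simp only [↓reduceIte, List.mem_flatMap, List.mem_map, List.mem_range, List.mem_cons, List.not_mem_nil,
        or_false] at h
      obtain ⟨j, ⟨i, hi, rfl⟩, hrow⟩ := h
      exact Or.inr (Or.inr (Or.inr (Or.inr (Or.inr ⟨rfl, i + 1, by omega, by omega, hrow⟩))))

/-- **Soundness, `k ≥ 1` form.** If `D ≤ d^X` and `D ≤ d^Z`, the weight distributions of `rs H^X`, `rs H^Z` are a feasible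
point of `cssLPRows n (rank H^X) (rank H^Z) D false`. [folklore] -/
theorem lpFeasible_cssLPRows_of_le (C : CSSCode RX RZ (Fin n)) {a b D : ℕ} (ha : C.HX.rank = a) (hb : C.HZ.rank = b)
    (hX : D ≤ C.dX) (hZ : D ≤ C.dZ) : LPFeasible (cssLPRows n a b D false) n (alphaOf C) (betaOf C) := by
  refine ⟨fun r => Nat.cast_nonneg _, fun r => Nat.cast_nonneg _, fun row hrow => ?_⟩
  rcases mem_cssLPRows hrow with rfl | rfl | rfl | rfl | ⟨j, hj, rfl | rfl⟩ | ⟨hk, -⟩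
  · exact sat_rowAlphaEq_zero C
  · exact sat_rowBetaEq_zero C
  · exact sat_rowAlphaSum C ha
  · exact sat_rowBetaSum C hb
  · exact sat_rowDualA C ha hj fun hjD v hv hvj =>
      C.swap.mem_rowSpX_of_hammingNorm_lt_dX ((C.mem_kerX_iff v).1 hv) (by rw [hvj, CSSCode.dX_swap]; omega)
  · exact sat_rowDualB C hb hj fun hjD v hv hvj =>
      C.mem_rowSpX_of_hammingNorm_lt_dX ((C.mem_kerZ_iff v).1 hv) (by rw [hvj]; omega)
  · exact absurd hk Bool.false_ne_true

/-- **Soundness, `k = 0` form.** If `rank H^X + rank H^Z = n` (so `rs H^X = ker H^Z`, `rs H^Z = ker H^X`) and every nonzero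
stabilizer has weight `≥ D`, the weight distributions are a feasible point of `cssLPRows n a b D true`. [folklore] -/
theorem lpFeasible_cssLPRows_zero (C : CSSCode RX RZ (Fin n)) {a b D : ℕ} (ha : C.HX.rank = a) (hb : C.HZ.rank = b)
    (hab : a + b = n) (hW : ∀ v ∈ C.toSympCode, v ≠ 0 → D ≤ sympWeight v) :
    LPFeasible (cssLPRows n a b D true) n (alphaOf C) (betaOf C) := by
  have hr : n ≤ C.HX.rank + C.HZ.rank := by rw [ha, hb, hab]
  have hXZ : C.rowSpX = C.kerZ := css_rowSpX_eq_kerZ_of_rank C hr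
  have hZX : C.rowSpZ = C.kerX := css_rowSpZ_eq_kerX_of_rank C hr
  -- nonzero words of either span have weight ≥ D
  have hA : ∀ v ∈ C.rowSpX, v ≠ 0 → D ≤ hammingNorm v := fun v hv hv0 => by
    have h := hW (v, 0) ((C.mem_toSympCode_iff _).2 ⟨hv, Submodule.zero_mem _⟩) fun h => hv0 (congrArg Prod.fst h)
    rwa [sympWeight_mk_zero_snd] at h
  have hB : ∀ v ∈ C.rowSpZ, v ≠ 0 → D ≤ hammingNorm v := fun v hv hv0 => by
    have h := hW (0, v) ((C.mem_toSympCode_iff _).2 ⟨Submodule.zero_mem _, hv⟩) fun h => hv0 (congrArg Prod.snd h)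
    rwa [sympWeight_mk_zero_fst] at h
  refine ⟨fun r => Nat.cast_nonneg _, fun r => Nat.cast_nonneg _, fun row hrow => ?_⟩
  rcases mem_cssLPRows hrow with rfl | rfl | rfl | rfl | ⟨j, hj, rfl | rfl⟩ | ⟨-, j, hj1, hjD, rfl | rfl⟩
  · exact sat_rowAlphaEq_zero C
  · exact sat_rowBetaEq_zero C
  · exact sat_rowAlphaSum C ha
  · exact sat_rowBetaSum C hb
  · exact sat_rowDualA C ha hj fun _ v hv _ => by rw [hZX]; exact hv
  · exact sat_rowDualB C hb hj fun _ v hv _ => by rw [hXZ]; exact hv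
  · -- α_j = 0 for 1 ≤ j ≤ D − 1
    refine ⟨fun _ => ?_, fun h => absurd h (by simp [rowAlphaEq])⟩
    simp only [rowAlphaEq, LPRow.eval, zero_mul, Finset.sum_const_zero, add_zero]
    by_cases hjn : j ≤ n
    · rw [sum_ite_eq_mul n j hjn, one_mul, alphaOf, Nat.cast_eq_zero]
      exact wdist_eq_zero_of_forall fun v hv hvj => by
        have h0 : v ≠ 0 := fun h => by rw [h, hammingNorm_zero] at hvj; omega
        have := hA v hv h0; omega
    · rw [Finset.sum_eq_zero fun r hr => by rw [mem_range] at hr; rw [if_neg (by omega), zero_mul]]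
  · refine ⟨fun _ => ?_, fun h => absurd h (by simp [rowBetaEq])⟩
    simp only [rowBetaEq, LPRow.eval, zero_mul, Finset.sum_const_zero, zero_add]
    by_cases hjn : j ≤ n
    · rw [sum_ite_eq_mul n j hjn, one_mul, betaOf, Nat.cast_eq_zero]
      exact wdist_eq_zero_of_forall fun v hv hvj => by
        have h0 : v ≠ 0 := fun h => by rw [h, hammingNorm_zero] at hvj; omega
        have := hB v hv h0; omega
    · rw [Finset.sum_eq_zero fun r hr => by rw [mem_range] at hr; rw [if_neg (by omega), zero_mul]]

/-! ## The census form -/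

/-- **No CSS code of a certified cell beats `D − 1`**: a checked Farkas certificate for `cssLPRows n a b D false` gives
`min (d^X, d^Z) < D` for every CSS code on `n` qubits with `rank H^X = a` and `rank H^Z = b`. [folklore] -/
theorem css_min_dX_dZ_lt_of_farkasCheck {a b D : ℕ} {ys : List ℚ} (h : farkasCheck (cssLPRows n a b D false) ys n = true)
    (C : CSSCode RX RZ (Fin n)) (ha : C.HX.rank = a) (hb : C.HZ.rank = b) : min C.dX C.dZ < D := by
  by_contra hge
  rw [not_lt, le_min_iff] at hge
  exact not_lpFeasible_of_farkasCheck h (lpFeasible_cssLPRows_of_le C ha hb hge.1 hge.2)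

/-- **Zero-rate cells**: a checked certificate for `cssLPRows n a b D true` with `a + b = n` gives, for every CSS code on
`n` qubits with `rank H^X = a`, `rank H^Z = b`, a nonzero stabilizer of weight `< D` (CRSS `k = 0` convention).
[folklore] -/
theorem css_exists_stabilizer_lt_of_farkasCheck {a b D : ℕ} {ys : List ℚ}
    (h : farkasCheck (cssLPRows n a b D true) ys n = true) (C : CSSCode RX RZ (Fin n)) (ha : C.HX.rank = a)
    (hb : C.HZ.rank = b) (hab : a + b = n) : ∃ v ∈ C.toSympCode, v ≠ 0 ∧ sympWeight v < D := by
  by_contra hall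
  push Not at hall
  exact not_lpFeasible_of_farkasCheck h (lpFeasible_cssLPRows_zero C ha hb hab hall)

end Soundness

end Summit.Ventures.QEC.Census
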